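import Summits.AnomalousDissipation.AnomalousDissipation.Theorems.BaireTransferDenseLoudDesignerForcesStubGalileanCovariance
import Summits.AnomalousDissipation.AnomalousDissipation.Theorems.BaireTransferDenseLoudDesignerForcesStubBoostBudgets
import Summits.AnomalousDissipation.AnomalousDissipation.Theorems.BaireTransferDenseLoudDesignerForcesStubUnboost

/-!
# The drift dictionary of the line `galilean-detuning-body-force-grid`
# (crux stmt-AnomalousDissipation-1143, `BaireTransfer.DenseLoudDesignerForces`; lead c2-0, skeleton v3)

What the line reduces the crux to, CERTIFIED.  Skeleton v3 of the line has one open stub, the residual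
`stub_driftLoudness` (one non-zero lattice drift `n` and one energy split `E_V + E_w ≤ E` per level `j` with
`U ⊆ closure (sweptLoudSet S E_w ε E_V n j)`).  This file states the residual in the CRUX'S OWN (lab-frame)
vocabulary and proves the two-sided dictionary:

* `driftLabLoudSet S E ε V T j` — the crux's loud set `Negative.loudSet S E ε j` with the witness's period `T`
  and its (constant) mean momentum `∫ u t = V` PRESCRIBED;
* `DenseLoudDesignerForcesDrift` — the crux `DenseLoudDesignerForces` verbatim, except that at each level the
  dense set is `driftLabLoudSet S E ε V T j` for SOME `V ≠ 0`, `T > 0` with `T • V ∈ ℤ³`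
  (lattice-commensurate non-zero drift): a RESTRICTION of the crux's witness class, hence a strengthening of
  the crux (`denseLoudDesignerForces_of_drift`, three lines, no Galilean input);
* `sweptLoudSet_subset_driftLabLoudSet` / `driftLabLoudSet_subset_sweptLoudSet` — the swept loud sets of the
  line ARE the drift-restricted lab loud sets (Galilean covariance p78980 one way, `galilean_unboost` p83890 the
  other, budgets by `BoostBudgets` p80760, mean momentum by Haar invariance), with the exact parameter
  dictionary `V = driftVel E_V n`, `T = driftPeriod E_V n`, resp. `E_V = ‖V‖²`, `E_w = E - ‖V‖²`;
* `driftLoudness_iff_denseLoudDesignerForcesDrift` — the v3 residual (verbatim the registered signature of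
  `stub_driftLoudness`) is EQUIVALENT to `DenseLoudDesignerForcesDrift`.

Reading: the line transfers the crux to the crux restricted to periodic classical witnesses with non-zero
lattice-commensurate mean momentum — it selects WHERE loud orbits are to be sought (the drift class, whose
laminar states are ν-uniformly bounded: `milestone_sweptLaminarWitness`, p85696), it does not reduce WHAT has
to be proved (loud periodic orbits at every small viscosity, densely in the force).  No facts are asserted.

References: Frisch, *Turbulence* (1995) §5.2 (Galilean invariance, grid turbulence); the route file
`Theses/BaireTransfer.lean` (item 1143); `Cruxes/DenseLoudDesignerForces/Lines/galilean_detuning_body_force_grid.lean`.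
-/

-- `Summit.<Summit>.<Problem>` is the tree's mandated summit-side namespace (CONVENTIONS §2); for this
-- single-conjunct summit the two coincide, so the duplicate is deliberate.
set_option linter.dupNamespace false

noncomputable section

open scoped BigOperators Topology InnerProductSpace
open Filter Set Function MeasureTheory

-- sub-namespace of the Line vocabulary namespace, so `sweptForce`, `boost`, `sweptLoudSet`, … resolve unqualified
namespace Summit.AnomalousDissipation.AnomalousDissipation.Theorems.DenseLoudDesignerForces.Galilean.DriftDictionary

open Literature.Analysis.FunctionSpaces Literature.Analysis.FluidPDE
open Summit.AnomalousDissipation.AnomalousDissipation.Theses.BaireTransfer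
open Summit.AnomalousDissipation.AnomalousDissipation.Theorems.DenseLoudDesignerForces.Negative

/-- The flat unit torus `T³`. -/
local notation "𝕋³" => UnitAddTorus (Fin 3)
/-- Real velocity values. -/
local notation "ℝ³" => EuclideanSpace ℝ (Fin 3)
/-- Complex Fourier coefficient values. -/
local notation "ℂ³" => EuclideanSpace ℂ (Fin 3)
/-- The frequency / drift lattice `ℤ³`. -/
local notation "ℤ³" => Fin 3 → ℤ

/-! ## §1 The drift-restricted loud set and the drift-restricted crux (lab frame) -/

/-- **Drift-restricted loud set** (lab frame): the crux's `LOUD_j(S, E, ε)` with the witness's period `T` and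
its constant mean momentum `V = ∫ u t` prescribed — coefficient vectors `c` whose steady designer force `f_c`
carries, at some `ν < 1/(j+1)`, a `T`-periodic classical solution `(u, p)` of NS_ν on `ℝ × T³` with
`∫ u t = V` for all `t`, `meanEnergy u ≤ E` and `meanDissipation ν u ≥ ε`. [folklore] -/
def driftLabLoudSet (S : Finset ℤ³) (E ε : ℝ) (V : ℝ³) (T : ℝ) (j : ℕ) : Set (↥S → ℂ³) :=
  {c | ∃ ν : ℝ, 0 < ν ∧ ν < 1 / ((j : ℝ) + 1) ∧
    ∃ (u : ℝ → 𝕋³ → ℝ³) (p : ℝ → 𝕋³ → ℝ),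
      Torus.IsClassicalNSSolutionOn Set.univ ν (fun _ => force S c) u p ∧
      Function.Periodic u T ∧ (∀ t, ∫ x, u t x = V) ∧
      meanEnergy u ≤ E ∧ ε ≤ meanDissipation ν u}

/-- **The drift-restricted crux** `DenseLoudDesignerForcesDrift`: verbatim `DenseLoudDesignerForces`, except
that at every level the dense loud set is the drift-restricted one for SOME non-zero lattice-commensurate
drift (`V ≠ 0`, `0 < T`, `T • V = latticeVec n`).  This is the residual of the line
`galilean-detuning-body-force-grid` in lab-frame vocabulary (`driftLoudness_iff_denseLoudDesignerForcesDrift`);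
a restriction of the route's own crux, posited by the line — not a literature fact. -/
def DenseLoudDesignerForcesDrift : Prop :=
  ∀ S₀ : Finset ℤ³, ∃ S : Finset ℤ³, S₀ ⊆ S ∧ ∃ (E ε : ℝ), 0 < ε ∧
    ∃ U : Set (↥S → ℂ³), IsOpen U ∧ U.Nonempty ∧
      ∀ j : ℕ, ∃ (V : ℝ³) (T : ℝ) (n : ℤ³), V ≠ 0 ∧ 0 < T ∧ T • V = Torus.latticeVec n ∧
        U ⊆ closure (driftLabLoudSet S E ε V T j)

/-- Forgetting the prescriptions: a drift-restricted loud point is a loud point (`0 < T` is the crux's `0 < τ`). [folklore] -/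
theorem driftLabLoudSet_subset_loudSet (S : Finset ℤ³) (E ε : ℝ) (V : ℝ³) {T : ℝ} (hT : 0 < T) (j : ℕ) :
    driftLabLoudSet S E ε V T j ⊆ loudSet S E ε j := by
  rintro c ⟨ν, hν, hνj, u, p, hsol, hper, -, hE, hε⟩
  exact ⟨ν, hν, hνj, T, u, p, hT, hsol, hper, hE, hε⟩

/-- **The drift-restricted crux implies the crux** (restriction of the witness class; no Galilean input). [folklore] -/
theorem denseLoudDesignerForces_of_drift (h : DenseLoudDesignerForcesDrift) : DenseLoudDesignerForces := by
  refine denseLoudDesignerForces_iff.2 fun S₀ => ?_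
  obtain ⟨S, hS, E, ε, hε, U, hU, hne, hlev⟩ := h S₀
  refine ⟨S, hS, E, ε, hε, U, hU, hne, fun j => ?_⟩
  obtain ⟨V, T, n, -, hT, -, hsub⟩ := hlev j
  exact hsub.trans (closure_mono (driftLabLoudSet_subset_loudSet S E ε V hT j))

/-! ## §2 Mean momentum under boost / unboost (Haar invariance) -/

/-- Mean momentum of a boost slice: `∫ (V + w t (x - a)) dx = V + ∫ w t` for a smooth slice. [folklore] -/
theorem integral_boost {V : ℝ³} {w : ℝ → 𝕋³ → ℝ³} (hw : Torus.IsSmoothSpaceTimeOn univ w) (t : ℝ) :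
    ∫ x, boost V w t x = V + ∫ x, w t x := by
  have hs : Torus.IsSmooth (w t) := hw.isSmooth_slice (mem_univ t)
  have h1 : ∫ x, boost V w t x = ∫ x, (V + w t x) :=
    integral_sub_right_eq_self (μ := (volume : Measure 𝕋³)) (fun y => V + w t y) (Torus.proj (t • V))
  rw [h1, integral_add (integrable_const V) hs.integrable, integral_const, probReal_univ, one_smul]

/-- Mean momentum of an unboost slice: `∫ (u t (y + a) - V) dy = ∫ u t - V` for a smooth slice. [folklore] -/
theorem integral_unboost {V : ℝ³} {u : ℝ → 𝕋³ → ℝ³} (hu : Torus.IsSmoothSpaceTimeOn univ u) (t : ℝ) (a : 𝕋³) :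
    ∫ y, (u t (y + a) - V) = (∫ x, u t x) - V := by
  have hs : Torus.IsSmooth (u t) := hu.isSmooth_slice (mem_univ t)
  have h1 : ∫ y, (u t (y + a) - V) = ∫ y, (u t y - V) :=
    integral_add_right_eq_self (μ := (volume : Measure 𝕋³)) (fun y => u t y - V) a
  rw [h1, integral_sub hs.integrable (integrable_const V), integral_const, probReal_univ, one_smul]

/-! ## §3 The parameter dictionary `(E_V, n) ↔ (V, T)` -/

/-- `driftVel E_V n ≠ 0` for `E_V > 0`, `n ≠ 0`. [folklore] -/
theorem driftVel_ne_zero {EV : ℝ} (hEV : 0 < EV) {n : ℤ³} (hn : n ≠ 0) : driftVel EV n ≠ 0 := by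
  intro h
  have := norm_driftVel (EV := EV) hn
  rw [h, norm_zero] at this
  exact (Real.sqrt_pos.2 hEV).ne' this.symm

/-- A lattice-commensurate non-zero drift has a non-zero lattice label. [folklore] -/
theorem ne_zero_of_smul_eq_latticeVec {V : ℝ³} {T : ℝ} {n : ℤ³} (hV : V ≠ 0) (hT : 0 < T)
    (hTV : T • V = Torus.latticeVec n) : n ≠ 0 := by
  rintro rfl
  rw [Torus.latticeVec_zero, smul_eq_zero] at hTV
  exact hTV.elim (fun h => hT.ne' h) hV

/-- Inverse dictionary, velocity: for `V ≠ 0`, `0 < T`, `T • V = latticeVec n`, `driftVel ‖V‖² n = V`. [folklore] -/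
theorem driftVel_norm_sq {V : ℝ³} {T : ℝ} {n : ℤ³} (hV : V ≠ 0) (hT : 0 < T)
    (hTV : T • V = Torus.latticeVec n) : driftVel (‖V‖ ^ 2) n = V := by
  have hVn : 0 < ‖V‖ := norm_pos_iff.2 hV
  unfold driftVel
  rw [← hTV, norm_smul, Real.norm_of_nonneg hT.le, Real.sqrt_sq hVn.le, smul_smul]
  have : ‖V‖ / (T * ‖V‖) * T = 1 := by
    field_simp
  rw [this, one_smul]

/-- Inverse dictionary, period: for `V ≠ 0`, `0 < T`, `T • V = latticeVec n`, `driftPeriod ‖V‖² n = T`. [folklore] -/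
theorem driftPeriod_norm_sq {V : ℝ³} {T : ℝ} {n : ℤ³} (hV : V ≠ 0) (hT : 0 < T)
    (hTV : T • V = Torus.latticeVec n) : driftPeriod (‖V‖ ^ 2) n = T := by
  have hVn : 0 < ‖V‖ := norm_pos_iff.2 hV
  unfold driftPeriod
  rw [← hTV, norm_smul, Real.norm_of_nonneg hT.le, Real.sqrt_sq hVn.le]
  field_simp

/-! ## §4 The two inclusions -/

/-- **Swept ⇒ lab** (Galilean covariance p78980 + boost budgets p80760 + mean momentum by Haar invariance):
for `E_V > 0`, `n ≠ 0`, `E_V + E_w ≤ E`, every point of `sweptLoudSet S E_w ε E_V n j` lies in the drift-restricted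
lab loud set with `V = driftVel E_V n`, `T = driftPeriod E_V n`, lab witness `boost V w`. [folklore] -/
theorem sweptLoudSet_subset_driftLabLoudSet {S : Finset ℤ³} {E Ew ε EV : ℝ} {n : ℤ³} {j : ℕ}
    (hEV : 0 < EV) (hn : n ≠ 0) (hE : EV + Ew ≤ E) :
    sweptLoudSet S Ew ε EV n j ⊆ driftLabLoudSet S E ε (driftVel EV n) (driftPeriod EV n) j := by
  rintro c ⟨ν, hν, hνj, w, q, hsol, hper, hmean, hEw, hεw⟩
  have hT : 0 < driftPeriod EV n := driftPeriod_pos hEV hn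
  have hTV : driftPeriod EV n • driftVel EV n = Torus.latticeVec n := driftPeriod_smul_driftVel hEV hn
  have hw : Torus.IsSmoothSpaceTimeOn univ w := hsol.smooth_velocity
  refine ⟨ν, hν, hνj, boost (driftVel EV n) w, boostScalar (driftVel EV n) q,
    Covariance.stub_galileanCovariance ν (driftVel EV n) (force S c) w q hsol, boost_periodic hTV hper,
    fun t => ?_, ?_, ?_⟩
  · rw [integral_boost hw t, show ∫ x, w t x = 0 from hmean t, add_zero]
  · rw [BoostBudgets.meanEnergy_boost hT hTV hw hper hmean, norm_driftVel_sq hEV.le hn]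
    linarith
  · rw [BoostBudgets.meanDissipation_boost ν hw]
    exact hεw

/-- **Lab ⇒ swept** (`galilean_unboost` p83890 + boost budgets p80760 read backwards): for `V ≠ 0`, `0 < T`,
`T • V = latticeVec n`, every point of the drift-restricted lab loud set lies in
`sweptLoudSet S (E - ‖V‖²) ε ‖V‖² n j`, swept witness `w t y = u t (y + [tV]) - V`. [folklore] -/
theorem driftLabLoudSet_subset_sweptLoudSet {S : Finset ℤ³} {E ε : ℝ} {V : ℝ³} {T : ℝ} {n : ℤ³} {j : ℕ}
    (hV : V ≠ 0) (hT : 0 < T) (hTV : T • V = Torus.latticeVec n) :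
    driftLabLoudSet S E ε V T j ⊆ sweptLoudSet S (E - ‖V‖ ^ 2) ε (‖V‖ ^ 2) n j := by
  rintro c ⟨ν, hν, hνj, u, p, hsol, hper, hmean, hE, hε⟩
  set w : ℝ → 𝕋³ → ℝ³ := fun t y => u t (y + Torus.proj (t • V)) - V with hw_def
  set q : ℝ → 𝕋³ → ℝ := fun t y => p t (y + Torus.proj (t • V)) with hq_def
  have hsolw : Torus.IsClassicalNSSolutionOn Set.univ ν (sweptForce V (force S c)) w q :=
    Unboost.galilean_unboost ν V (force S c) u p hsol
  have hw : Torus.IsSmoothSpaceTimeOn univ w := hsolw.smooth_velocity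
  have hu : Torus.IsSmoothSpaceTimeOn univ u := hsol.smooth_velocity
  -- `u` is the boost of its own unboost
  have hbu : boost V w = u := by
    funext t x
    simp only [boost, hw_def, sub_add_cancel, add_sub_cancel]
  -- periodicity of the unboost (lattice-commensurability kills the extra shift)
  have hperw : Function.Periodic w T := by
    intro t
    funext y
    simp only [hw_def]
    rw [hper t, add_smul, Torus.proj_add, hTV, Torus.proj_latticeVec, add_zero]
  -- momentum-free
  have hmeanw : ∀ t, Torus.HasZeroMean (w t) := by
    intro t
    show ∫ y, w t y = 0
    simp only [hw_def]
    rw [integral_unboost hu t, hmean t, sub_self]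
  -- budgets
  have hEn : meanEnergy u = ‖V‖ ^ 2 + meanEnergy w := by
    rw [← hbu]
    exact BoostBudgets.meanEnergy_boost hT hTV hw hperw hmeanw
  have hDis : meanDissipation ν u = meanDissipation ν w := by
    rw [← hbu]
    exact BoostBudgets.meanDissipation_boost ν hw
  refine ⟨ν, hν, hνj, w, q, ?_, ?_, hmeanw, ?_, ?_⟩
  · rw [driftVel_norm_sq hV hT hTV]
    exact hsolw
  · rw [driftPeriod_norm_sq hV hT hTV]
    exact hperw
  · linarith
  · rw [← hDis]
    exact hε

/-! ## §5 The residual of the line is the drift-restricted crux -/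

/-- **Dictionary theorem**: the v3 residual `stub_driftLoudness` of the line `galilean-detuning-body-force-grid`
(verbatim its registered signature, as the left-hand side) is EQUIVALENT to the drift-restricted crux
`DenseLoudDesignerForcesDrift`.  (→) `V = driftVel E_V n`, `T = driftPeriod E_V n` and
`sweptLoudSet_subset_driftLabLoudSet`; (←) `E_V = ‖V‖²`, `E_w = E - ‖V‖²`, the same `n`, and
`driftLabLoudSet_subset_sweptLoudSet`. [folklore] -/
theorem driftLoudness_iff_denseLoudDesignerForcesDrift :
    (∀ S₀ : Finset ℤ³, ∃ S : Finset ℤ³, S₀ ⊆ S ∧ ∃ (E ε : ℝ), 0 < ε ∧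
      ∃ U : Set (↥S → ℂ³), IsOpen U ∧ U.Nonempty ∧
        ∀ j : ℕ, ∃ (EV Ew : ℝ) (n : ℤ³), 0 < EV ∧ n ≠ 0 ∧ EV + Ew ≤ E ∧
          U ⊆ closure (sweptLoudSet S Ew ε EV n j)) ↔
    DenseLoudDesignerForcesDrift := by
  constructor
  · intro h S₀
    obtain ⟨S, hS, E, ε, hε, U, hU, hne, hlev⟩ := h S₀
    refine ⟨S, hS, E, ε, hε, U, hU, hne, fun j => ?_⟩
    obtain ⟨EV, Ew, n, hEV, hn, hE, hsub⟩ := hlev j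
    exact ⟨driftVel EV n, driftPeriod EV n, n, driftVel_ne_zero hEV hn, driftPeriod_pos hEV hn,
      driftPeriod_smul_driftVel hEV hn,
      hsub.trans (closure_mono (sweptLoudSet_subset_driftLabLoudSet hEV hn hE))⟩
  · intro h S₀
    obtain ⟨S, hS, E, ε, hε, U, hU, hne, hlev⟩ := h S₀
    refine ⟨S, hS, E, ε, hε, U, hU, hne, fun j => ?_⟩
    obtain ⟨V, T, n, hV, hT, hTV, hsub⟩ := hlev j
    refine ⟨‖V‖ ^ 2, E - ‖V‖ ^ 2, n, by positivity, ne_zero_of_smul_eq_latticeVec hV hT hTV, by linarith,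
      hsub.trans (closure_mono (driftLabLoudSet_subset_sweptLoudSet hV hT hTV))⟩

/-- **Corollary**: the v3 residual implies the crux BY NAME (the skeleton's composition, factored through the
dictionary; equivalently `mem_loudSet_of_swept_witness` directly). [folklore] -/
theorem denseLoudDesignerForces_of_driftLoudness
    (h : ∀ S₀ : Finset ℤ³, ∃ S : Finset ℤ³, S₀ ⊆ S ∧ ∃ (E ε : ℝ), 0 < ε ∧
      ∃ U : Set (↥S → ℂ³), IsOpen U ∧ U.Nonempty ∧
        ∀ j : ℕ, ∃ (EV Ew : ℝ) (n : ℤ³), 0 < EV ∧ n ≠ 0 ∧ EV + Ew ≤ E ∧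
          U ⊆ closure (sweptLoudSet S Ew ε EV n j)) :
    DenseLoudDesignerForces :=
  denseLoudDesignerForces_of_drift (driftLoudness_iff_denseLoudDesignerForcesDrift.1 h)

/-! ## §6 Per-witness drift: the drift CLASS (skeleton v4's residual)

Skeleton v3 fixed ONE drift `(E_V, n)` per level before asking density; the composition needs less: each
loud point may bring its own drift.  The per-witness ("drift class") forms below are implied by the v3 forms
(`driftClassLoudness_of_driftLoudness`, `driftClass_of_drift`), still imply the crux by restriction, and are
again equivalent across the Galilean dictionary (`driftClassLoudness_iff_denseLoudDesignerForcesDriftClass`). -/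

/-- **Drift-class loud set** (lab frame): loud points of level `j` carrying a witness with SOME non-zero
lattice-commensurate drift — `⋃ {driftLabLoudSet S E ε V T j : V ≠ 0, 0 < T, T • V ∈ latticeVec ℤ³}`. [folklore] -/
def driftClassLoudSet (S : Finset ℤ³) (E ε : ℝ) (j : ℕ) : Set (↥S → ℂ³) :=
  {c | ∃ (V : ℝ³) (T : ℝ) (n : ℤ³), V ≠ 0 ∧ 0 < T ∧ T • V = Torus.latticeVec n ∧
    c ∈ driftLabLoudSet S E ε V T j}

/-- **Swept drift-class loud set** (the line's vocabulary): points of SOME swept loud set of level `j` with drift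
energy `E_V > 0`, lattice label `n ≠ 0` and fluctuation budget `E_w`, `E_V + E_w ≤ E`. [folklore] -/
def sweptClassLoudSet (S : Finset ℤ³) (E ε : ℝ) (j : ℕ) : Set (↥S → ℂ³) :=
  {c | ∃ (EV Ew : ℝ) (n : ℤ³), 0 < EV ∧ n ≠ 0 ∧ EV + Ew ≤ E ∧ c ∈ sweptLoudSet S Ew ε EV n j}

/-- **The drift-class crux** `DenseLoudDesignerForcesDriftClass`: verbatim `DenseLoudDesignerForces` with the
witness class restricted, witness by witness, to periodic classical solutions with non-zero constant mean
momentum `V` and a period `T` with `T • V ∈ ℤ³`.  Posited by the line (skeleton v4's residual in lab-frame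
vocabulary); a restriction of the route's own crux — not a literature fact. -/
def DenseLoudDesignerForcesDriftClass : Prop :=
  ∀ S₀ : Finset ℤ³, ∃ S : Finset ℤ³, S₀ ⊆ S ∧ ∃ (E ε : ℝ), 0 < ε ∧
    ∃ U : Set (↥S → ℂ³), IsOpen U ∧ U.Nonempty ∧
      ∀ j : ℕ, U ⊆ closure (driftClassLoudSet S E ε j)

/-- The drift-class loud set is contained in the crux's loud set. [folklore] -/
theorem driftClassLoudSet_subset_loudSet (S : Finset ℤ³) (E ε : ℝ) (j : ℕ) :
    driftClassLoudSet S E ε j ⊆ loudSet S E ε j := by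
  rintro c ⟨V, T, n, -, hT, -, hc⟩
  exact driftLabLoudSet_subset_loudSet S E ε V hT j hc

/-- **The drift-class crux implies the crux** (restriction of the witness class). [folklore] -/
theorem denseLoudDesignerForces_of_driftClass (h : DenseLoudDesignerForcesDriftClass) :
    DenseLoudDesignerForces := by
  refine denseLoudDesignerForces_iff.2 fun S₀ => ?_
  obtain ⟨S, hS, E, ε, hε, U, hU, hne, hlev⟩ := h S₀
  exact ⟨S, hS, E, ε, hε, U, hU, hne, fun j =>
    (hlev j).trans (closure_mono (driftClassLoudSet_subset_loudSet S E ε j))⟩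

/-- One drift per level is a special case of one drift per witness: `DenseLoudDesignerForcesDrift →
DenseLoudDesignerForcesDriftClass`. [folklore] -/
theorem driftClass_of_drift (h : DenseLoudDesignerForcesDrift) : DenseLoudDesignerForcesDriftClass := by
  intro S₀
  obtain ⟨S, hS, E, ε, hε, U, hU, hne, hlev⟩ := h S₀
  refine ⟨S, hS, E, ε, hε, U, hU, hne, fun j => ?_⟩
  obtain ⟨V, T, n, hV, hT, hTV, hsub⟩ := hlev j
  exact hsub.trans (closure_mono fun c hc => ⟨V, T, n, hV, hT, hTV, hc⟩)

/-- **Swept class = drift class** (the two inclusions of §4, witness by witness). [folklore] -/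
theorem sweptClassLoudSet_eq_driftClassLoudSet (S : Finset ℤ³) (E ε : ℝ) (j : ℕ) :
    sweptClassLoudSet S E ε j = driftClassLoudSet S E ε j := by
  ext c
  constructor
  · rintro ⟨EV, Ew, n, hEV, hn, hE, hc⟩
    exact ⟨driftVel EV n, driftPeriod EV n, n, driftVel_ne_zero hEV hn, driftPeriod_pos hEV hn,
      driftPeriod_smul_driftVel hEV hn, sweptLoudSet_subset_driftLabLoudSet hEV hn hE hc⟩
  · rintro ⟨V, T, n, hV, hT, hTV, hc⟩
    exact ⟨‖V‖ ^ 2, E - ‖V‖ ^ 2, n, by positivity, ne_zero_of_smul_eq_latticeVec hV hT hTV, by linarith,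
      driftLabLoudSet_subset_sweptLoudSet hV hT hTV hc⟩

/-- **Dictionary theorem, drift-class form**: skeleton v4's residual `stub_driftClassLoudness` (verbatim its
registered signature, as the left-hand side: swept vocabulary, the set-builder unfolding of `sweptClassLoudSet`)
is EQUIVALENT to the drift-class crux `DenseLoudDesignerForcesDriftClass`. [folklore] -/
theorem driftClassLoudness_iff_denseLoudDesignerForcesDriftClass :
    (∀ S₀ : Finset ℤ³, ∃ S : Finset ℤ³, S₀ ⊆ S ∧ ∃ (E ε : ℝ), 0 < ε ∧
      ∃ U : Set (↥S → ℂ³), IsOpen U ∧ U.Nonempty ∧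
        ∀ j : ℕ, U ⊆ closure {c | ∃ (EV Ew : ℝ) (n : ℤ³), 0 < EV ∧ n ≠ 0 ∧ EV + Ew ≤ E ∧
          c ∈ sweptLoudSet S Ew ε EV n j}) ↔
    DenseLoudDesignerForcesDriftClass := by
  have key : ∀ (S : Finset ℤ³) (E ε : ℝ) (j : ℕ),
      {c : ↥S → ℂ³ | ∃ (EV Ew : ℝ) (n : ℤ³), 0 < EV ∧ n ≠ 0 ∧ EV + Ew ≤ E ∧ c ∈ sweptLoudSet S Ew ε EV n j} =
        driftClassLoudSet S E ε j :=
    fun S E ε j => sweptClassLoudSet_eq_driftClassLoudSet S E ε j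
  simp only [key]
  rfl

/-- v3's residual (one drift per level) implies v4's (one drift per witness). [folklore] -/
theorem driftClassLoudness_of_driftLoudness
    (h : ∀ S₀ : Finset ℤ³, ∃ S : Finset ℤ³, S₀ ⊆ S ∧ ∃ (E ε : ℝ), 0 < ε ∧
      ∃ U : Set (↥S → ℂ³), IsOpen U ∧ U.Nonempty ∧
        ∀ j : ℕ, ∃ (EV Ew : ℝ) (n : ℤ³), 0 < EV ∧ n ≠ 0 ∧ EV + Ew ≤ E ∧
          U ⊆ closure (sweptLoudSet S Ew ε EV n j)) :
    ∀ S₀ : Finset ℤ³, ∃ S : Finset ℤ³, S₀ ⊆ S ∧ ∃ (E ε : ℝ), 0 < ε ∧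
      ∃ U : Set (↥S → ℂ³), IsOpen U ∧ U.Nonempty ∧
        ∀ j : ℕ, U ⊆ closure {c | ∃ (EV Ew : ℝ) (n : ℤ³), 0 < EV ∧ n ≠ 0 ∧ EV + Ew ≤ E ∧
          c ∈ sweptLoudSet S Ew ε EV n j} :=
  driftClassLoudness_iff_denseLoudDesignerForcesDriftClass.2
    (driftClass_of_drift (driftLoudness_iff_denseLoudDesignerForcesDrift.1 h))

/-- **Corollary**: skeleton v4's residual implies the crux BY NAME. [folklore] -/
theorem denseLoudDesignerForces_of_driftClassLoudness
    (h : ∀ S₀ : Finset ℤ³, ∃ S : Finset ℤ³, S₀ ⊆ S ∧ ∃ (E ε : ℝ), 0 < ε ∧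
      ∃ U : Set (↥S → ℂ³), IsOpen U ∧ U.Nonempty ∧
        ∀ j : ℕ, U ⊆ closure {c | ∃ (EV Ew : ℝ) (n : ℤ³), 0 < EV ∧ n ≠ 0 ∧ EV + Ew ≤ E ∧
          c ∈ sweptLoudSet S Ew ε EV n j}) :
    DenseLoudDesignerForces :=
  denseLoudDesignerForces_of_driftClass (driftClassLoudness_iff_denseLoudDesignerForcesDriftClass.1 h)

end Summit.AnomalousDissipation.AnomalousDissipation.Theorems.DenseLoudDesignerForces.Galilean.DriftDictionary

end
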